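import Literature.Topology.FourManifolds.GompfShearModel
import HarnessLib

/-!
# The kink model: a straightening in standard form whose monodromy is linear far from the base point

Infrastructure for the framed form of R. Gompf, *More Cappell–Shaneson spheres are standard*,
Algebr. Geom. Topol. 10 (2010), Theorem 2.1 / §4 ¶3 (the named fact
`Literature.Topology.FourManifolds.gompf2010_framedTwist`). The geometric core of Theorem 2.1 (the
fishtail neighbourhood and Lemma 2.2) only involves a neighbourhood of one fibre and of the cylinder
swept by Gompf's circle `α` (loc. cit., proof of Thm 2.1: the punctured torus `F`, the box `N`);
to transfer it from **one** straightened model to the straightened monodromy of an arbitrary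
matrix in standard form one needs a model whose monodromy, on a tube around `α` (the first
coordinate circle), has the shape of Gompf's picture: the identity near the base point and the
*linear* map far from it, with `ψ(α) ⊂ T = {z₂ = 1}` ("the isotopy corresponding to each
straightening of `A` can be chosen to keep `φ(α)` within the torus `T`", §4 ¶3). The shear model of
`GompfShearModel.lean` concentrates the whole Dehn twist of `T` into an arc instead. This file
constructs the **kink model** by a closed formula:

* `Literature.Topology.FourManifolds.cutArg` — the argument of the circle cut off by the bump
  `nearBump`: smooth on the whole circle, equal to `arg` on `|arg z| ≤ 1`, zero where `re z ≤ 0`;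
* `Literature.Topology.FourManifolds.kinkStage t (z₁, z₂, z₃) = (z₁ w, z₂, z₃ w⁻¹)`,
  `w = e^{i t χ(z₂) cutArg(z₁ z₃)}` — a one-parameter group of translations of `T³` along the
  direction `e₁ - e₃` driven by the "diagonal" `z₁ z₃` and cut off in `z₂`
  (`kinkStage_kinkStage`), based at `1`, exactly linear on the cube `|vᵢ| < 1/2` with germs
  `Literature.Topology.FourManifolds.kinkLin t = !![1 + t, 0, t; 0, 1, 0; -t, 0, 1 - t]`
  (`kinkStage_expT`); the diffeotopy `Literature.Topology.FourManifolds.kinkDiffeotopy`;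
* `Literature.Topology.FourManifolds.kinkMatrix = !![0, 0, -1; 0, 1, 0; 1, 0, 2] ∈ SL(3, ℤ)` — a
  matrix of the shape of Gompf's standard form (first column `e₃`, §3) with
  `kinkLin 1 = kinkMatrix⁻¹`, and **`Literature.Topology.FourManifolds.kinkStraightening :
  Straightening kinkMatrix`** (`Straightening`, `GompfFramedTwistTransport.lean`);
* the monodromy `Literature.Topology.FourManifolds.kinkMonodromy = kinkMatrix ∘ kinkStage 1`:
  `(z₁, z₂, z₃) ↦ (z₃⁻¹ w, z₂, z₁ z₃² w⁻¹)` (`coe_kinkMonodromy`); it preserves `z₂` and the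
  diagonal `z₁ z₃` (`kinkMonodromy_diag`: it is a gauge transformation of the circle fibration of
  `T³` in the direction `e₃ - e₁`, hence commutes with every twist `torusTwist F` along that
  direction driven by `z₂`, `kinkMonodromy_torusTwist` — in particular with Gompf's Dehn twist
  `farDehn`); it is the identity on the cube (`kinkMonodromy_expT`) and the **linear** map
  `kinkMatrix` wherever `re (z₁ z₃) ≤ 0` or `re z₂ ≤ 0` (`kinkMonodromy_of_re_diag_le`,
  `kinkMonodromy_of_re_le`); on the first coordinate circle `α` it is the **kink curve**
  `z₁ ↦ (e^{i cutArg z₁}, 1, z₁ e^{-i cutArg z₁})` inside `T = {z₂ = 1}`, equal to `α` near `1`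
  and to the third coordinate circle far from `1` (`kinkMonodromy_axis`,
  `kinkMonodromy_axis_of_abs_le`, `kinkMonodromy_axis_of_re_le`).

Everything here is proved; no named facts are introduced.

## References

* R. E. Gompf, *More Cappell–Shaneson spheres are standard*, Algebr. Geom. Topol. 10 (2010)
  1665–1681: §2 ¶1 (`φ` the identity near `p`), §3 (standard form, the torus `T` spanned by the
  first and third axes), §4 Def. 4.1, ¶2 and ¶3. [GompfAGT2010]
-/

open scoped Manifold ContDiff Topology Real
open Set Function Metric Filter Complex

noncomputable section

namespace Literature.Topology.FourManifolds

/-- Local notation: `𝔼 n` is the model Euclidean space `EuclideanSpace ℝ (Fin n)`. -/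
local notation "𝔼 " n:arg => EuclideanSpace ℝ (Fin n)

/-- Local notation: the model with corners `𝓣 = (𝓡 1).prod ((𝓡 1).prod (𝓡 1))` of `ThreeTorus`. -/
local notation "𝓣" =>
  (ModelWithCorners.prod (𝓡 1) (ModelWithCorners.prod (𝓡 1) (𝓡 1)))

attribute [local instance] finrank_real_complex_fact'

/-! ### The cut-off argument -/

section CutArg

/-- **The cut-off argument** `cutArg z = χ(z) · arg z` with `χ = nearBump`: smooth on the whole
circle (the bump vanishes near the branch cut of `arg`), equal to `arg z` where `|arg z| ≤ 1` and to
`0` where `re z ≤ 0`. [folklore] -/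
def cutArg (z : Circle) : ℝ := nearBump z * arg (z : ℂ)

/-- A point of the circle outside the slit plane is `-1`, so its real part is negative. [folklore] -/
theorem re_neg_of_not_mem_slitPlane {z : Circle} (hz : (z : ℂ) ∉ slitPlane) : (z : ℂ).re < 0 := by
  have h : (z : ℂ) = -1 := by
    by_contra h
    exact hz (mem_slitPlane_of_norm_eq_one (Circle.norm_coe z) h)
  rw [h]
  norm_num

/-- **The cut-off argument is smooth on the circle.** [folklore] -/
theorem contMDiff_cutArg : ContMDiff (𝓡 1) 𝓘(ℝ, ℝ) ∞ cutArg := by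
  intro z
  by_cases hz : (z : ℂ) ∈ slitPlane
  · exact contMDiff_nearBump.contMDiffAt.mul (contMDiffAt_arg_circle hz)
  · have hre : (z : ℂ).re < 0 := re_neg_of_not_mem_slitPlane hz
    have hopen : IsOpen {w : Circle | ((w : ℂ)).re < 0} :=
      isOpen_lt (Complex.continuous_re.comp continuous_subtype_val) continuous_const
    have hev : cutArg =ᶠ[𝓝 z] fun _ ↦ (0 : ℝ) := by
      filter_upwards [hopen.mem_nhds hre] with w hw
      rw [cutArg, nearBump_eq_zero (le_of_lt hw), zero_mul]
    exact contMDiffAt_const.congr_of_eventuallyEq hev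

/-- **On the arc `|θ| ≤ 1` the cut-off argument of `e^{iθ}` is `θ`.** [folklore] -/
theorem cutArg_exp {θ : ℝ} (hθ : |θ| ≤ 1) : cutArg (Circle.exp θ) = θ := by
  have hπ := Real.pi_gt_three
  have h := abs_le.1 hθ
  rw [cutArg, nearBump_exp hθ, one_mul, Circle.arg_exp (by linarith) (by linarith)]

/-- The cut-off argument vanishes where `re z ≤ 0`. [folklore] -/
theorem cutArg_eq_zero {z : Circle} (hz : (z : ℂ).re ≤ 0) : cutArg z = 0 := by
  rw [cutArg, nearBump_eq_zero hz, zero_mul]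

/-- `cutArg 1 = 0`. [folklore] -/
@[simp] theorem cutArg_one : cutArg 1 = 0 := by
  have h := cutArg_exp (θ := 0) (by norm_num)
  rwa [Circle.exp_zero] at h

end CutArg

/-! ### The kink stages: a one-parameter group of diagonal-driven translations -/

section Kink

/-- **The phase** `t χ(z₂) cutArg(z₁ z₃)` of the kink stages. [folklore] -/
def kinkPhase (t : ℝ) (z : ThreeTorus) : ℝ := t * nearBump z.2.1 * cutArg (z.1 * z.2.2)

/-- **The kink factor** `w = e^{i t χ(z₂) cutArg(z₁ z₃)} ∈ 𝕊¹`. [folklore] -/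
def kinkFactor (t : ℝ) (z : ThreeTorus) : Circle := Circle.exp (kinkPhase t z)

/-- **The kink stages** `F_t (z₁, z₂, z₃) = (z₁ w, z₂, z₃ w⁻¹)`: translation of `T³` along
`e₁ - e₃` by the phase — a map preserving `z₂` and the diagonal `z₁ z₃` which drive it. [cite: GompfAGT2010, §3 ¶1 (straightening the linear diffeomorphism near 0)] -/
def kinkStage (t : ℝ) (z : ThreeTorus) : ThreeTorus := (z.1 * kinkFactor t z, z.2.1, z.2.2 * (kinkFactor t z)⁻¹)

/-- The phase is additive in `t`. [folklore] -/
theorem kinkPhase_add (s t : ℝ) (z : ThreeTorus) : kinkPhase (s + t) z = kinkPhase s z + kinkPhase t z := by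
  simp only [kinkPhase]; ring

/-- The phase vanishes at `t = 0`. [folklore] -/
@[simp] theorem kinkPhase_zero (z : ThreeTorus) : kinkPhase 0 z = 0 := by simp [kinkPhase]

/-- The factor is `1` at `t = 0`. [folklore] -/
@[simp] theorem kinkFactor_zero (z : ThreeTorus) : kinkFactor 0 z = 1 := by simp [kinkFactor]

/-- The stages preserve the second coordinate. [folklore] -/
@[simp] theorem kinkStage_snd_fst (t : ℝ) (z : ThreeTorus) : (kinkStage t z).2.1 = z.2.1 := rfl

/-- **The stages preserve the diagonal `z₁ z₃`.** [folklore] -/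
@[simp] theorem kinkStage_diag (t : ℝ) (z : ThreeTorus) :
    (kinkStage t z).1 * (kinkStage t z).2.2 = z.1 * z.2.2 := by
  simp only [kinkStage]
  rw [mul_assoc, mul_comm (kinkFactor t z), mul_assoc, inv_mul_cancel, mul_one]

/-- Hence the phase is invariant under the stages. [folklore] -/
theorem kinkPhase_kinkStage (s t : ℝ) (z : ThreeTorus) : kinkPhase s (kinkStage t z) = kinkPhase s z := by
  rw [kinkPhase, kinkPhase, kinkStage_diag, kinkStage_snd_fst]

/-- The factor is invariant under the stages. [folklore] -/
theorem kinkFactor_kinkStage (s t : ℝ) (z : ThreeTorus) : kinkFactor s (kinkStage t z) = kinkFactor s z := by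
  rw [kinkFactor, kinkFactor, kinkPhase_kinkStage]

/-- The factor is multiplicative in `t`. [folklore] -/
theorem kinkFactor_add (s t : ℝ) (z : ThreeTorus) : kinkFactor (s + t) z = kinkFactor s z * kinkFactor t z := by
  rw [kinkFactor, kinkFactor, kinkFactor, kinkPhase_add, Circle.exp_add]

/-- **The stages form a one-parameter group**: `F_s ∘ F_t = F_{s + t}`. [folklore] -/
theorem kinkStage_kinkStage (s t : ℝ) (z : ThreeTorus) : kinkStage s (kinkStage t z) = kinkStage (s + t) z := by
  have hf := kinkFactor_kinkStage s t z
  simp only [kinkStage] at hf ⊢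
  rw [hf, kinkFactor_add, mul_inv]
  ext1
  · simp only [mul_assoc, mul_comm (kinkFactor t z)]
  · ext1
    · rfl
    · simp only [mul_assoc, mul_comm ((kinkFactor t z)⁻¹)]

/-- The stage at `t = 0` is the identity. [folklore] -/
@[simp] theorem kinkStage_zero (z : ThreeTorus) : kinkStage 0 z = z := by
  simp [kinkStage]

/-- `F_{-t}` inverts `F_t`. [folklore] -/
theorem kinkStage_neg_kinkStage (t : ℝ) (z : ThreeTorus) : kinkStage (-t) (kinkStage t z) = z := by
  rw [kinkStage_kinkStage, neg_add_cancel, kinkStage_zero]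

/-- `F_t` inverts `F_{-t}`. [folklore] -/
theorem kinkStage_kinkStage_neg (t : ℝ) (z : ThreeTorus) : kinkStage t (kinkStage (-t) z) = z := by
  rw [kinkStage_kinkStage, add_neg_cancel, kinkStage_zero]

/-- The phase is jointly smooth in `(t, z)`. [folklore] -/
theorem contMDiff_kinkPhase_uncurry : ContMDiff (𝓘(ℝ, ℝ).prod 𝓣) 𝓘(ℝ, ℝ) ∞ (uncurry kinkPhase) := by
  have h1 : ContMDiff (𝓘(ℝ, ℝ).prod 𝓣) 𝓘(ℝ, ℝ) ∞ fun p : ℝ × ThreeTorus ↦ nearBump p.2.2.1 :=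
    contMDiff_nearBump.comp (contMDiff_fst.comp (contMDiff_snd.comp contMDiff_snd))
  have h2 : ContMDiff (𝓘(ℝ, ℝ).prod 𝓣) (𝓡 1) ∞ fun p : ℝ × ThreeTorus ↦ p.2.1 * p.2.2.2 :=
    (contMDiff_fst.comp contMDiff_snd).mul (contMDiff_snd.comp (contMDiff_snd.comp contMDiff_snd))
  have h3 : ContMDiff (𝓘(ℝ, ℝ).prod 𝓣) 𝓘(ℝ, ℝ) ∞ fun p : ℝ × ThreeTorus ↦ cutArg (p.2.1 * p.2.2.2) :=
    contMDiff_cutArg.comp h2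
  exact (contMDiff_fst.mul h1).mul h3

/-- The factor is jointly smooth in `(t, z)`. [folklore] -/
theorem contMDiff_kinkFactor_uncurry : ContMDiff (𝓘(ℝ, ℝ).prod 𝓣) (𝓡 1) ∞ (uncurry kinkFactor) :=
  contMDiff_circleExp.comp contMDiff_kinkPhase_uncurry

/-- **The stages are jointly smooth.** [folklore] -/
theorem contMDiff_kinkStage_uncurry : ContMDiff (𝓘(ℝ, ℝ).prod 𝓣) 𝓣 ∞ (uncurry kinkStage) :=
  ((contMDiff_fst.comp contMDiff_snd).mul contMDiff_kinkFactor_uncurry).prodMk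
    ((contMDiff_fst.comp (contMDiff_snd.comp contMDiff_snd)).prodMk
      ((contMDiff_snd.comp (contMDiff_snd.comp contMDiff_snd)).mul contMDiff_kinkFactor_uncurry.inv))

/-- The inverse stages `F_{-t}` are jointly smooth. [folklore] -/
theorem contMDiff_kinkStage_neg_uncurry :
    ContMDiff (𝓘(ℝ, ℝ).prod 𝓣) 𝓣 ∞ (uncurry fun t ↦ kinkStage (-t)) := by
  have h : ContMDiff (𝓘(ℝ, ℝ).prod 𝓣) (𝓘(ℝ, ℝ).prod 𝓣) ∞ fun p : ℝ × ThreeTorus ↦ (-p.1, p.2) :=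
    contMDiff_fst.neg.prodMk contMDiff_snd
  exact contMDiff_kinkStage_uncurry.comp h

/-- **The kink diffeotopy** `t ↦ F_t` of `T³` (a one-parameter group, inverse stages `F_{-t}`). [cite: GompfAGT2010, §3 ¶1 (straightening the linear diffeomorphism near 0)] -/
def kinkDiffeotopy : Diffeotopy 𝓣 ThreeTorus :=
  Diffeotopy.mk' 𝓣 kinkStage (fun t ↦ kinkStage (-t)) contMDiff_kinkStage_uncurry
    contMDiff_kinkStage_neg_uncurry kinkStage_neg_kinkStage kinkStage_kinkStage_neg
    (funext kinkStage_zero)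

/-- The stages (definitional). [folklore] -/
@[simp] theorem kinkDiffeotopy_toFun (t : ℝ) : kinkDiffeotopy.toFun t = kinkStage t := rfl

/-- The inverse stages (definitional). [folklore] -/
@[simp] theorem kinkDiffeotopy_invFun (t : ℝ) : kinkDiffeotopy.invFun t = kinkStage (-t) := rfl

/-- At the base point the factor is `1`. [folklore] -/
@[simp] theorem kinkFactor_one (t : ℝ) : kinkFactor t 1 = 1 := by
  simp [kinkFactor, kinkPhase]

/-- **The kink diffeotopy is based at `1`.** [folklore] -/
theorem kinkStage_one (t : ℝ) : kinkStage t 1 = 1 := by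
  simp [kinkStage]

/-! ### Exact linearity on the cube `|vᵢ| < 1/2` -/

/-- **The linear parts** `G_t = !![1 + t, 0, t; 0, 1, 0; -t, 0, 1 - t]` of the kink stages at `1`:
`G_t = 1 + t N` with `N = (e₁ - e₃)(e₁ + e₃)ᵀ` of square zero. [folklore] -/
def kinkLin (t : ℝ) : Matrix (Fin 3) (Fin 3) ℝ := !![1 + t, 0, t; 0, 1, 0; -t, 0, 1 - t]

/-- The nilpotent direction `N = (e₁ - e₃)(e₁ + e₃)ᵀ`. [folklore] -/
def kinkNil : Matrix (Fin 3) (Fin 3) ℝ := !![1, 0, 1; 0, 0, 0; -1, 0, -1]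

/-- `G_t = 1 + t N`. [folklore] -/
theorem kinkLin_eq (t : ℝ) : kinkLin t = 1 + t • kinkNil := by
  ext i j
  fin_cases i <;> fin_cases j <;> simp [kinkLin, kinkNil, sub_eq_add_neg]

/-- `G_s G_t = G_{s + t}` (`N² = 0`). [folklore] -/
theorem kinkLin_mul (s t : ℝ) : kinkLin s * kinkLin t = kinkLin (s + t) := by
  ext i j
  fin_cases i <;> fin_cases j <;> simp [kinkLin, Matrix.mul_apply, Fin.sum_univ_three] <;> ring

/-- `G_0 = 1`. [folklore] -/
@[simp] theorem kinkLin_zero : kinkLin 0 = 1 := by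
  ext i j
  fin_cases i <;> fin_cases j <;> simp [kinkLin]

/-- `G_t G_{-t} = 1`. [folklore] -/
theorem kinkLin_mul_neg (t : ℝ) : kinkLin t * kinkLin (-t) = 1 := by
  rw [kinkLin_mul, add_neg_cancel, kinkLin_zero]

/-- `G_{-t} G_t = 1`. [folklore] -/
theorem kinkLin_neg_mul (t : ℝ) : kinkLin (-t) * kinkLin t = 1 := by
  rw [kinkLin_mul, neg_add_cancel, kinkLin_zero]

/-- The entries of `G_t` are smooth (affine) in `t`. [folklore] -/
theorem contDiff_kinkLin_apply (i j : Fin 3) : ContDiff ℝ ∞ fun t ↦ kinkLin t i j := by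
  simp_rw [kinkLin_eq, Matrix.add_apply, Matrix.smul_apply, smul_eq_mul]
  exact contDiff_const.add (contDiff_id.mul contDiff_const)

/-- The coordinates of `G_t v`: `(v₀ + t (v₀ + v₂), v₁, v₂ - t (v₀ + v₂))`. [folklore] -/
theorem mulVecE_kinkLin (t : ℝ) (v : 𝔼 3) :
    mulVecE (kinkLin t) v 0 = v 0 + t * (v 0 + v 2) ∧ mulVecE (kinkLin t) v 1 = v 1 ∧
      mulVecE (kinkLin t) v 2 = v 2 - t * (v 0 + v 2) := by
  simp only [mulVecE_apply, kinkLin, Fin.sum_univ_three, Matrix.of_apply, Matrix.cons_val',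
    Matrix.cons_val_zero, Matrix.cons_val_one, Matrix.cons_val_two, Matrix.cons_val_fin_one,
    Matrix.empty_val', Matrix.head_cons, Matrix.tail_cons, Matrix.head_fin_const]
  refine ⟨by ring, by ring, by ring⟩

/-- **The kink factor in exponential coordinates**: for `|vᵢ| < 1/2`,
`kinkFactor t (expT v) = e^{i t (v₀ + v₂)}`. [folklore] -/
theorem kinkFactor_expT (t : ℝ) (v : 𝔼 3) (hv : ∀ i, |v i| < 1 / 2) :
    kinkFactor t (expT v) = Circle.exp (t * (v 0 + v 2)) := by
  have h0 := abs_lt.1 (hv 0)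
  have h1 := hv 1
  have h2 := abs_lt.1 (hv 2)
  have h02 : |v 0 + v 2| ≤ 1 := abs_le.2 ⟨by linarith, by linarith⟩
  rw [kinkFactor, kinkPhase]
  show Circle.exp (t * nearBump (Circle.exp (v 1)) * cutArg (Circle.exp (v 0) * Circle.exp (v 2))) = _
  rw [nearBump_exp (by linarith [h1.le] : |v 1| ≤ 1), mul_one, ← Circle.exp_add, cutArg_exp h02]

/-- **Exact linearity of the stages on the cube**: `F_t (expT v) = expT (G_t v)` for `|vᵢ| < 1/2`. [cite: GompfAGT2010, §3 ¶1 (straightening the linear diffeomorphism near 0)] -/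
theorem kinkStage_expT (t : ℝ) (v : 𝔼 3) (hv : ∀ i, |v i| < 1 / 2) :
    kinkStage t (expT v) = expT (mulVecE (kinkLin t) v) := by
  obtain ⟨h0, h1, h2⟩ := mulVecE_kinkLin t v
  have hf := kinkFactor_expT t v hv
  rw [kinkStage, hf]
  show (Circle.exp (v 0) * Circle.exp (t * (v 0 + v 2)), Circle.exp (v 1),
    Circle.exp (v 2) * (Circle.exp (t * (v 0 + v 2)))⁻¹) = (Circle.exp _, Circle.exp _, Circle.exp _)
  rw [h0, h1, h2, ← Circle.exp_neg, ← Circle.exp_add, ← Circle.exp_add, ← sub_eq_add_neg]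

/-- **Exact linearity of the inverse stages on the cube**: `F_t⁻¹ (expT v) = expT (G_{-t} v)`. [folklore] -/
theorem kinkStage_neg_expT (t : ℝ) (v : 𝔼 3) (hv : ∀ i, |v i| < 1 / 2) :
    kinkStage (-t) (expT v) = expT (mulVecE (kinkLin (-t)) v) :=
  kinkStage_expT (-t) v hv

end Kink

/-! ### The kink matrix and its straightening -/

section Model

/-- **The kink matrix** `M₀ = !![0, 0, -1; 0, 1, 0; 1, 0, 2] ∈ SL(3, ℤ)`:
`(z₁, z₂, z₃) ↦ (z₃⁻¹, z₂, z₁ z₃²)`, of the shape of Gompf's standard form (first column `e₃`: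
it maps the first coordinate circle onto the third), a gauge transformation of the fibration of
`T³` by the circles in the direction `e₃ - e₁`. [cite: GompfAGT2010, §3 (standard form)] -/
def kinkMatrix : Matrix.SpecialLinearGroup (Fin 3) ℤ :=
  ⟨!![0, 0, -1; 0, 1, 0; 1, 0, 2], by decide⟩

/-- The entries of the kink matrix. [folklore] -/
@[simp] theorem coe_kinkMatrix :
    ((kinkMatrix : Matrix.SpecialLinearGroup (Fin 3) ℤ) : Matrix (Fin 3) (Fin 3) ℤ) =
      !![0, 0, -1; 0, 1, 0; 1, 0, 2] := rfl

/-- The inverse of the kink matrix is `!![2, 0, 1; 0, 1, 0; -1, 0, 0]`. [folklore] -/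
theorem coe_kinkMatrix_inv :
    ((kinkMatrix⁻¹ : Matrix.SpecialLinearGroup (Fin 3) ℤ) : Matrix (Fin 3) (Fin 3) ℤ) =
      !![2, 0, 1; 0, 1, 0; -1, 0, 0] := by
  rw [Matrix.SpecialLinearGroup.coe_inv]
  decide

/-- **The real matrix of `M₀⁻¹` is `G_1`.** [folklore] -/
theorem slRealMatrix_kinkMatrix_inv : slRealMatrix kinkMatrix⁻¹ = kinkLin 1 := by
  ext i j
  rw [slRealMatrix, coe_kinkMatrix_inv]
  fin_cases i <;> fin_cases j <;> norm_num [kinkLin]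

/-- The real matrix of `M₀` is `G_{-1}`. [folklore] -/
theorem slRealMatrix_kinkMatrix : slRealMatrix kinkMatrix = kinkLin (-1) := by
  ext i j
  fin_cases i <;> fin_cases j <;> norm_num [slRealMatrix, kinkMatrix, kinkLin]

/-- **The kink straightening of `M₀`**: the kink diffeotopy, with exactly linear germs `G_t` on
the cube `|vᵢ| < 1/2` (`Straightening`, `GompfFramedTwistTransport.lean`). [cite: GompfAGT2010, Def. 4.1 and §4 ¶2 (X^σ depends only on the straightening class σ)] -/
def kinkStraightening : Straightening kinkMatrix where
  D := kinkDiffeotopy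
  based := kinkStage_one
  G := kinkLin
  Ginv t := kinkLin (-t)
  contDiff_G := contDiff_kinkLin_apply
  contDiff_Ginv i j := (contDiff_kinkLin_apply i j).comp contDiff_neg
  G_mul_Ginv := kinkLin_mul_neg
  Ginv_mul_G := kinkLin_neg_mul
  G_zero := kinkLin_zero
  G_one := slRealMatrix_kinkMatrix_inv.symm
  R := 1 / 2
  R_pos := by norm_num
  toFun_expT := kinkStage_expT
  invFun_expT := kinkStage_neg_expT

/-- **The linear map `M₀` on `T³` in coordinates**: `(z₁, z₂, z₃) ↦ (z₃⁻¹, z₂, z₁ z₃²)`. [folklore] -/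
theorem torusMap_kinkMatrix (z : ThreeTorus) :
    torusMap (kinkMatrix : Matrix (Fin 3) (Fin 3) ℤ) z = (z.2.2⁻¹, z.2.1, z.1 * z.2.2 ^ 2) := by
  refine torusCoord_injective (funext fun i ↦ ?_)
  rw [torusCoord_torusMap]
  fin_cases i <;> simp [torusMonomial, torusCoord, kinkMatrix, Fin.prod_univ_three, zpow_ofNat]

/-- Commutative-group algebra in `𝕊¹` is checked in `ℂ`. [folklore] -/
theorem circle_eq_of_coe_eq {a b : Circle} (h : (a : ℂ) = (b : ℂ)) : a = b := Subtype.ext h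

/-- **The kink monodromy** `ψ_K = M₀ ∘ F₁`, the monodromy of the kink model. [cite: GompfAGT2010, §2 (definition of X_φ and X_φ^ε)] -/
abbrev kinkMonodromy : ThreeTorus ≃ₘ⟮𝓣, 𝓣⟯ ThreeTorus := kinkStraightening.monodromy

/-- **The formula of the kink monodromy**: `ψ_K (z₁, z₂, z₃) = (z₃⁻¹ w, z₂, z₁ z₃² w⁻¹)`,
`w = kinkFactor 1 z`. [folklore] -/
theorem coe_kinkMonodromy (z : ThreeTorus) :
    kinkMonodromy z = (z.2.2⁻¹ * kinkFactor 1 z, z.2.1, z.1 * z.2.2 ^ 2 * (kinkFactor 1 z)⁻¹) := by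
  rw [kinkMonodromy, Straightening.monodromy, Diffeomorph.coe_trans, comp_apply, Diffeotopy.coe_stage,
    coe_torusDiffeomorph]
  show torusMap (kinkMatrix : Matrix (Fin 3) (Fin 3) ℤ) (kinkDiffeotopy.toFun 1 z) = _
  rw [kinkDiffeotopy_toFun, torusMap_kinkMatrix, kinkStage]
  ext1
  · exact circle_eq_of_coe_eq (by push_cast; field_simp)
  · ext1
    · rfl
    · exact circle_eq_of_coe_eq (by push_cast; field_simp)

/-- **`ψ_K` preserves the second coordinate.** [folklore] -/
theorem kinkMonodromy_snd_fst (z : ThreeTorus) : (kinkMonodromy z).2.1 = z.2.1 := by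
  rw [coe_kinkMonodromy]

/-- **`ψ_K` preserves the diagonal `z₁ z₃`**: it is a gauge transformation of the fibration of `T³`
by the circles in the direction `e₃ - e₁` over the torus of `(z₁ z₃, z₂)`. [folklore] -/
theorem kinkMonodromy_diag (z : ThreeTorus) : (kinkMonodromy z).1 * (kinkMonodromy z).2.2 = z.1 * z.2.2 := by
  rw [coe_kinkMonodromy]
  exact circle_eq_of_coe_eq (by push_cast; field_simp)

/-- **`ψ_K` as a translation along `e₃ - e₁`**: `ψ_K z = (z₁ μ⁻¹, z₂, z₃ μ)` with
`μ = z₁ z₃ w⁻¹`. [folklore] -/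
theorem coe_kinkMonodromy' (z : ThreeTorus) :
    kinkMonodromy z = (z.1 * (z.1 * z.2.2 * (kinkFactor 1 z)⁻¹)⁻¹, z.2.1,
      z.2.2 * (z.1 * z.2.2 * (kinkFactor 1 z)⁻¹)) := by
  rw [coe_kinkMonodromy]
  ext1
  · exact circle_eq_of_coe_eq (by push_cast; field_simp)
  · ext1
    · rfl
    · exact circle_eq_of_coe_eq (by push_cast; ring)

/-- **`ψ_K` commutes with every twist along `e₃ - e₁` driven by `z₂`** (`torusTwist F`:
`(z₁, z₂, z₃) ↦ (z₁ F(z₂)⁻¹, z₂, z₃ F(z₂))`; in particular with Gompf's Dehn twist `farDehn`):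
both are gauge transformations of the same circle fibration. [cite: GompfAGT2010, Thm 2.1 (hypothesis: the framings induced by T on α and φ(α) correspond under φ)] -/
theorem kinkMonodromy_torusTwist (F : Circle → Circle) (z : ThreeTorus) :
    kinkMonodromy (torusTwist F z) = torusTwist F (kinkMonodromy z) := by
  have hd : (torusTwist F z).1 * (torusTwist F z).2.2 = z.1 * z.2.2 := by
    rw [torusTwist_fst, torusTwist_snd_snd]
    exact circle_eq_of_coe_eq (by push_cast; field_simp)
  have hF : kinkFactor 1 (torusTwist F z) = kinkFactor 1 z := by
    rw [kinkFactor, kinkFactor, kinkPhase, kinkPhase, hd, torusTwist_snd_fst]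
  rw [coe_kinkMonodromy, coe_kinkMonodromy, hF]
  simp only [torusTwist]
  ext1
  · exact circle_eq_of_coe_eq (by push_cast; field_simp)
  · ext1
    · rfl
    · exact circle_eq_of_coe_eq (by push_cast; field_simp)

/-- **`ψ_K` is the identity on the cube `|vᵢ| < 1/2`** (in particular near `1`). [cite: GompfAGT2010, §2 ¶1 (φ restricts to the identity near p)] -/
theorem kinkMonodromy_expT (v : 𝔼 3) (hv : ∀ i, |v i| < 1 / 2) : kinkMonodromy (expT v) = expT v :=
  kinkStraightening.monodromy_expT v hv

/-- `ψ_K 1 = 1`. [folklore] -/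
theorem kinkMonodromy_one : kinkMonodromy 1 = 1 := kinkStraightening.monodromy_one

/-- The kink factor is `1` where `re (z₁ z₃) ≤ 0`. [folklore] -/
theorem kinkFactor_of_re_diag_le (t : ℝ) {z : ThreeTorus} (hz : ((z.1 * z.2.2 : Circle) : ℂ).re ≤ 0) :
    kinkFactor t z = 1 := by
  rw [kinkFactor, kinkPhase, cutArg_eq_zero hz, mul_zero, Circle.exp_zero]

/-- The kink factor is `1` where `re z₂ ≤ 0`. [folklore] -/
theorem kinkFactor_of_re_le (t : ℝ) {z : ThreeTorus} (hz : ((z.2.1 : Circle) : ℂ).re ≤ 0) :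
    kinkFactor t z = 1 := by
  rw [kinkFactor, kinkPhase, nearBump_eq_zero hz, mul_zero, zero_mul, Circle.exp_zero]

/-- **`ψ_K` is the linear map `M₀` where `re (z₁ z₃) ≤ 0`**: far from the base point along the
diagonal, `ψ_K (z₁, z₂, z₃) = (z₃⁻¹, z₂, z₁ z₃²)`. [folklore] -/
theorem kinkMonodromy_of_re_diag_le {z : ThreeTorus} (hz : ((z.1 * z.2.2 : Circle) : ℂ).re ≤ 0) :
    kinkMonodromy z = (z.2.2⁻¹, z.2.1, z.1 * z.2.2 ^ 2) := by
  rw [coe_kinkMonodromy, kinkFactor_of_re_diag_le 1 hz]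
  simp

/-- **`ψ_K` is the linear map `M₀` off the support of the bump**: where `re z₂ ≤ 0`,
`ψ_K (z₁, z₂, z₃) = (z₃⁻¹, z₂, z₁ z₃²)`. [folklore] -/
theorem kinkMonodromy_of_re_le {z : ThreeTorus} (hz : ((z.2.1 : Circle) : ℂ).re ≤ 0) :
    kinkMonodromy z = (z.2.2⁻¹, z.2.1, z.1 * z.2.2 ^ 2) := by
  rw [coe_kinkMonodromy, kinkFactor_of_re_le 1 hz]
  simp

/-! ### The kink curve: the image of the first coordinate circle -/

/-- **The turning angle of the kink**: `kinkTurn z₁ = e^{i cutArg z₁}`, equal to `z₁` near `1` and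
to `1` where `re z₁ ≤ 0`. [folklore] -/
def kinkTurn (z₁ : Circle) : Circle := Circle.exp (cutArg z₁)

/-- On the first coordinate circle the kink factor is the turning angle. [folklore] -/
theorem kinkFactor_axis (z₁ : Circle) : kinkFactor 1 (z₁, 1, 1) = kinkTurn z₁ := by
  rw [kinkFactor, kinkPhase, kinkTurn]
  simp

/-- **`ψ_K` on the first coordinate circle `α` is the kink curve**
`z₁ ↦ (kinkTurn z₁, 1, z₁ (kinkTurn z₁)⁻¹)` — a curve in the torus `T = {z₂ = 1}` spanned by the
first and third coordinate circles ("the isotopy … can be chosen to keep `φ(α)` within the torus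
`T`", Gompf 2010, §4 ¶3). [cite: GompfAGT2010, §4 ¶3 (the isotopy keeps φ(α) within T)] -/
theorem kinkMonodromy_axis (z₁ : Circle) :
    kinkMonodromy (z₁, 1, 1) = (kinkTurn z₁, 1, z₁ * (kinkTurn z₁)⁻¹) := by
  rw [coe_kinkMonodromy, kinkFactor_axis]
  simp

/-- Near `1` the turning angle is the identity: `kinkTurn (e^{iθ}) = e^{iθ}` for `|θ| ≤ 1`. [folklore] -/
theorem kinkTurn_exp {θ : ℝ} (hθ : |θ| ≤ 1) : kinkTurn (Circle.exp θ) = Circle.exp θ := by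
  rw [kinkTurn, cutArg_exp hθ]

/-- Far from `1` the turning angle is trivial: `kinkTurn z₁ = 1` for `re z₁ ≤ 0`. [folklore] -/
theorem kinkTurn_of_re_le {z₁ : Circle} (hz : (z₁ : ℂ).re ≤ 0) : kinkTurn z₁ = 1 := by
  rw [kinkTurn, cutArg_eq_zero hz, Circle.exp_zero]

/-- **Near the base point the kink curve is `α` itself**: `ψ_K (e^{iθ}, 1, 1) = (e^{iθ}, 1, 1)` for
`|θ| ≤ 1`. [cite: GompfAGT2010, §2 ¶1 (φ restricts to the identity near p)] -/
theorem kinkMonodromy_axis_of_abs_le {θ : ℝ} (hθ : |θ| ≤ 1) :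
    kinkMonodromy (Circle.exp θ, 1, 1) = (Circle.exp θ, 1, 1) := by
  rw [kinkMonodromy_axis, kinkTurn_exp hθ, mul_inv_cancel]

/-- **Far from the base point the kink curve is the third coordinate circle**:
`ψ_K (z₁, 1, 1) = (1, 1, z₁)` for `re z₁ ≤ 0` (there `ψ_K` is the linear `M₀`, which maps the
first coordinate circle onto the third). [cite: GompfAGT2010, §3 (standard form: A maps v to Av)] -/
theorem kinkMonodromy_axis_of_re_le {z₁ : Circle} (hz : (z₁ : ℂ).re ≤ 0) :
    kinkMonodromy (z₁, 1, 1) = (1, 1, z₁) := by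
  rw [kinkMonodromy_axis, kinkTurn_of_re_le hz, inv_one, mul_one]

/-- **The kink curve lies in the torus `T = {z₂ = 1}`.** [cite: GompfAGT2010, §4 ¶3 (the isotopy keeps φ(α) within T)] -/
theorem kinkMonodromy_axis_snd_fst (z₁ : Circle) : (kinkMonodromy (z₁, 1, 1)).2.1 = 1 := by
  rw [kinkMonodromy_axis]

/-- **The kink model sphere**: the product-framed surgery of the mapping torus of `ψ_K` along its
section circle (`Straightening.prodSphere`). [cite: GompfAGT2010, §2 (definition of X_φ and X_φ^ε)] -/
abbrev kinkSphere : Type := kinkStraightening.prodSphere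

/-- **The framed Cappell–Shaneson spheres of `M₀` in the straightening class of the kink model are
the kink model sphere** (`Straightening.nonempty_diffeomorph_gompfSphere_prodSphere_of_homotopic`). [cite: GompfAGT2010, §4 ¶2 (X^{τ·σ}_ψ = X^σ_φ)] -/
theorem nonempty_diffeomorph_gompfSphere_kinkMatrix_kinkSphere
    (γ : SmoothMatrixPath (slRealMatrix kinkMatrix))
    (hγ : γ.toPath.Homotopic kinkStraightening.path.toPath) :
    Nonempty (gompfSphere kinkMatrix γ ≃ₘ⟮𝓡 4, 𝓡 4⟯ kinkSphere) :=
  kinkStraightening.nonempty_diffeomorph_gompfSphere_prodSphere_of_homotopic γ hγ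

end Model

end Literature.Topology.FourManifolds
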